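import Summits.AtomisticToContinuum.FouriersLaw.Theorems.OddSectorIrreversibilityResponseDensityGibbsCutoff
import Summits.AtomisticToContinuum.FouriersLaw.Theorems.BondHeatUncertaintySubdiffusiveBondHeatKernelGibbsB
import Summits.AtomisticToContinuum.FouriersLaw.Theorems.OddSectorIrreversibilityResponseDensityGibbsTranspose
import Literature.MathematicalPhysics.KineticTheory.LangevinChainLyapunov

/-!
# Energy cutoffs `χ_R = χ(H/R)` for the pinned chain: generator and carré du champ bounds

Helper file for item stmt-AtomisticToContinuum-9144 (`ResponseDensity`, route
`OddSectorIrreversibility`, sub-problem `FouriersLaw` of `AtomisticToContinuum`), part of the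
detailed-balance (hDUAL) line. For the cutoffs `χ_R(x) = smoothCutoff(H(x)/R)`, `R ≥ 1`, both baths at
temperature `T`, `Γ = carreDuChamp v_L v_R` (`L(fg) = fLg + gLf + Γ(f,g)`):

* `hasDerivAt_cutoffProfile`, `hasDerivAt_sqCutoffProfile`, … — the profiles `h ↦ χ(h/R)`, `h ↦ χ(h/R)²`
  (derivatives of `χ` from `…SubdiffusiveBondHeatKernelGibbsB.lean`);
* `pinnedChain_contDiff_cutoff`, `pinnedChain_hasCompactSupport_cutoff` — `χ_R ∈ C_c^∞`;
* `pinnedChain_carreDuChamp_hamiltonian` — `Γ(H, H) = 2γT (p_0² + p_{N-1}²)`;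
* `pinnedChain_carreDuChamp_cutoff_le` — `Γ(χ_R, χ_R) ≤ (S₁²/R²) 2γT (p_0² + p_{N-1}²)`;
* `pinnedChain_abs_generator_sqCutoff_le` — `|L(χ_R²)| ≤ γ(T A + B)(p_0² + p_{N-1}²) + 2γTB`
  with `A = 2(S₁² + S₂)`, `B = 2S₁` (`S₁, S₂` bounds of `χ', χ''`);
* `carreDuChamp_sq_sq`, `neg_carreDuChamp_sq_sq_le` — `Γ(χ², u²) = 4χuΓ(χ,u)` and the weighted
  Cauchy–Schwarz bound `-Γ(χ², u²) ≤ ½ χ² Γ(u,u) + 8 u² Γ(χ,χ)`.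

No definitions.
-/

noncomputable section

open MeasureTheory ProbabilityTheory Filter Topology Set Function Metric
open scoped NNReal ENNReal ContDiff

namespace Summit.AtomisticToContinuum.FouriersLaw.Theorems

open Literature.MathematicalPhysics.KineticTheory.HeatConduction
open Literature.Probability.Process Literature.MathematicalPhysics.KineticTheory OscillatorChain

variable {N : ℕ}

/-! ### The squared cutoff profile `h ↦ χ(h/R)²` -/

/-- The cutoff profile `h ↦ χ(h/R)` and its derivative. -/
theorem hasDerivAt_cutoffProfile (R h : ℝ) :
    HasDerivAt (fun h : ℝ => smoothCutoff (h / R)) (deriv smoothCutoff (h / R) / R) h := by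
  have h0 := (SubdiffusiveBondHeat.hasDerivAt_smoothCutoff (h / R)).comp h ((hasDerivAt_id' h).div_const R)
  refine (h0.congr_of_eventuallyEq (Eventually.of_forall fun x => rfl)).congr_deriv ?_
  ring

/-- `d/dh [χ'(h/R)/R] = χ''(h/R)/R²`. -/
theorem hasDerivAt_deriv_cutoffProfile (R h : ℝ) :
    HasDerivAt (fun h : ℝ => deriv smoothCutoff (h / R) / R) (deriv (deriv smoothCutoff) (h / R) / R ^ 2) h := by
  have h0 := (SubdiffusiveBondHeat.hasDerivAt_deriv_smoothCutoff (h / R)).comp h ((hasDerivAt_id' h).div_const R)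
  have h1 : HasDerivAt (fun h : ℝ => deriv smoothCutoff (h / R)) (deriv (deriv smoothCutoff) (h / R) * (1 / R)) h :=
    h0.congr_of_eventuallyEq (Eventually.of_forall fun x => rfl)
  refine (h1.div_const R).congr_deriv ?_
  ring

/-- `d/dh χ(h/R)² = 2 χ(h/R) χ'(h/R) / R`. -/
theorem hasDerivAt_sqCutoffProfile (R h : ℝ) :
    HasDerivAt (fun h : ℝ => smoothCutoff (h / R) ^ 2)
      (2 * smoothCutoff (h / R) * deriv smoothCutoff (h / R) / R) h := by
  have h2 := (hasDerivAt_cutoffProfile R h).pow 2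
  refine h2.congr_deriv ?_
  simp only [Nat.cast_ofNat, Nat.add_one_sub_one, pow_one]
  ring

/-- `d/dh [2 χ(h/R) χ'(h/R) / R] = 2 (χ'(h/R)² + χ(h/R) χ''(h/R)) / R²`. -/
theorem hasDerivAt_deriv_sqCutoffProfile (R h : ℝ) :
    HasDerivAt (fun h : ℝ => 2 * smoothCutoff (h / R) * deriv smoothCutoff (h / R) / R)
      (2 * (deriv smoothCutoff (h / R) ^ 2 +
        smoothCutoff (h / R) * deriv (deriv smoothCutoff) (h / R)) / R ^ 2) h := by
  have h1 := hasDerivAt_cutoffProfile R h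
  have h0 := (SubdiffusiveBondHeat.hasDerivAt_deriv_smoothCutoff (h / R)).comp h ((hasDerivAt_id' h).div_const R)
  have h2 : HasDerivAt (fun h : ℝ => deriv smoothCutoff (h / R)) (deriv (deriv smoothCutoff) (h / R) * (1 / R)) h :=
    h0.congr_of_eventuallyEq (Eventually.of_forall fun x => rfl)
  have h3 := ((h1.mul h2).const_mul 2).div_const R
  refine (h3.congr_of_eventuallyEq (Eventually.of_forall fun x => by simp only [Pi.mul_apply]; ring)).congr_deriv ?_
  ring

/-! ### Pointwise carré du champ algebra -/

section CarreDuChamp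

variable {E : Type*} [NormedAddCommGroup E] [NormedSpace ℝ E] (v₁ v₂ : E)

/-- `Γ(χ², u²) = 4 χ u Γ(χ, u)`. -/
theorem carreDuChamp_sq_sq {χ u : E → ℝ} (hχ : Differentiable ℝ χ) (hu : Differentiable ℝ u) (y : E) :
    carreDuChamp v₁ v₂ (fun y => χ y ^ 2) (fun y => u y ^ 2) y = 4 * χ y * u y * carreDuChamp v₁ v₂ χ u y := by
  have hsq : ∀ r : ℝ, HasDerivAt (fun r : ℝ => r ^ 2) (2 * r) r := fun r => by
    simpa using hasDerivAt_pow 2 r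
  rw [carreDuChamp_comp_left v₁ v₂ hsq hχ, carreDuChamp_comm, carreDuChamp_comp_left v₁ v₂ hsq hu,
    carreDuChamp_comm]
  ring

/-- **Weighted Cauchy–Schwarz for the carré du champ**: `-Γ(χ², u²) ≤ ½ χ² Γ(u,u) + 8 u² Γ(χ,χ)`
(`½(χ b + 4 u a)² ≥ 0` in each noise direction). -/
theorem neg_carreDuChamp_sq_sq_le {χ u : E → ℝ} (hχ : Differentiable ℝ χ) (hu : Differentiable ℝ u) (y : E) :
    -carreDuChamp v₁ v₂ (fun y => χ y ^ 2) (fun y => u y ^ 2) y ≤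
      (1 / 2) * (χ y ^ 2 * carreDuChamp v₁ v₂ u u y) + 8 * (u y ^ 2 * carreDuChamp v₁ v₂ χ χ y) := by
  rw [carreDuChamp_sq_sq v₁ v₂ hχ hu, carreDuChamp_def, carreDuChamp_def, carreDuChamp_def]
  nlinarith [sq_nonneg (χ y * fderiv ℝ u y v₁ + 4 * u y * fderiv ℝ χ y v₁),
    sq_nonneg (χ y * fderiv ℝ u y v₂ + 4 * u y * fderiv ℝ χ y v₂)]

end CarreDuChamp

/-! ### The cutoffs `χ_R = χ(H/R)` of the pinned chain -/

section Cutoff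

variable {ω₂ lam β γ : ℝ} (hω : 0 < ω₂) (hl : 0 ≤ lam) (hβ : 0 ≤ β) (N : ℕ)

/-- `χ_R ∈ C^∞`. -/
theorem pinnedChain_contDiff_cutoff (γ R : ℝ) :
    ContDiff ℝ ∞ fun x : PhaseSpace N => smoothCutoff ((pinnedChain ω₂ lam β γ).hamiltonian N x / R) :=
  (contDiff_smoothCutoff (n := ⊤)).comp ((pinnedChain_contDiff_hamiltonian ω₂ lam β γ N).div_const R)

include hω hl hβ in
/-- `χ_R` has compact support (`χ_R = 0` off the compact sublevel set `{H ≤ 2R}`, `R > 0`). -/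
theorem pinnedChain_hasCompactSupport_cutoff (γ : ℝ) {R : ℝ} (hR : 0 < R) :
    HasCompactSupport fun x : PhaseSpace N => smoothCutoff ((pinnedChain ω₂ lam β γ).hamiltonian N x / R) := by
  refine HasCompactSupport.intro (pinnedChain_isCompact_setOf_hamiltonian_le hω hl hβ γ N (2 * R))
    fun x hx => ?_
  simp only [Set.mem_setOf_eq, not_le] at hx
  exact smoothCutoff_of_two_le ((le_div_iff₀ hR).2 (by linarith))

include hω hl hβ in
/-- `χ_R²` has compact support. -/
theorem pinnedChain_hasCompactSupport_sqCutoff (γ : ℝ) {R : ℝ} (hR : 0 < R) :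
    HasCompactSupport fun x : PhaseSpace N => smoothCutoff ((pinnedChain ω₂ lam β γ).hamiltonian N x / R) ^ 2 := by
  have e : (fun x : PhaseSpace N => smoothCutoff ((pinnedChain ω₂ lam β γ).hamiltonian N x / R) ^ 2) =
      fun x => smoothCutoff ((pinnedChain ω₂ lam β γ).hamiltonian N x / R) *
        smoothCutoff ((pinnedChain ω₂ lam β γ).hamiltonian N x / R) := funext fun x => sq _
  rw [e]
  exact (pinnedChain_hasCompactSupport_cutoff hω hl hβ N γ hR).mul_right

/-- **`Γ(H, H) = 2γT (p_0² + p_{N-1}²)`** for both baths at `T` (`γT ≥ 0`, `N ≥ 1`). -/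
theorem pinnedChain_carreDuChamp_hamiltonian (hN : 0 < N) {T : ℝ} (hγT : 0 ≤ 2 * γ * T) (x : PhaseSpace N) :
    carreDuChamp ((pinnedChain ω₂ lam β γ).bathVecL N T) ((pinnedChain ω₂ lam β γ).bathVecR N T)
        ((pinnedChain ω₂ lam β γ).hamiltonian N) ((pinnedChain ω₂ lam β γ).hamiltonian N) x =
      2 * γ * T * (x.2 ⟨0, hN⟩ ^ 2 + x.2 ⟨N - 1, by omega⟩ ^ 2) := by
  have hH : Differentiable ℝ ((pinnedChain ω₂ lam β γ).hamiltonian N) :=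
    (pinnedChain_contDiff_hamiltonian ω₂ lam β γ N (n := 1)).differentiable one_ne_zero
  have hL : fderiv ℝ ((pinnedChain ω₂ lam β γ).hamiltonian N) x ((pinnedChain ω₂ lam β γ).bathVecL N T) =
      Real.sqrt (2 * γ * T) * x.2 ⟨0, hN⟩ :=
    SubdiffusiveBondHeat.fderiv_hamiltonian_bathVec (pinnedChain ω₂ lam β γ) hH x hN _
  have hR : fderiv ℝ ((pinnedChain ω₂ lam β γ).hamiltonian N) x ((pinnedChain ω₂ lam β γ).bathVecR N T) =
      Real.sqrt (2 * γ * T) * x.2 ⟨N - 1, by omega⟩ :=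
    SubdiffusiveBondHeat.fderiv_hamiltonian_bathVec (pinnedChain ω₂ lam β γ) hH x (by omega) _
  rw [carreDuChamp_def, hL, hR]
  have hc : Real.sqrt (2 * γ * T) ^ 2 = 2 * γ * T := Real.sq_sqrt hγT
  nlinarith [hc]

/-- **`Γ(χ_R, χ_R) = (χ'(H/R)/R)² · 2γT (p_0² + p_{N-1}²)`**. -/
theorem pinnedChain_carreDuChamp_cutoff (hN : 0 < N) {T : ℝ} (hγT : 0 ≤ 2 * γ * T) (R : ℝ) (x : PhaseSpace N) :
    carreDuChamp ((pinnedChain ω₂ lam β γ).bathVecL N T) ((pinnedChain ω₂ lam β γ).bathVecR N T)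
        (fun y => smoothCutoff ((pinnedChain ω₂ lam β γ).hamiltonian N y / R))
        (fun y => smoothCutoff ((pinnedChain ω₂ lam β γ).hamiltonian N y / R)) x =
      (deriv smoothCutoff ((pinnedChain ω₂ lam β γ).hamiltonian N x / R) / R) ^ 2 *
        (2 * γ * T * (x.2 ⟨0, hN⟩ ^ 2 + x.2 ⟨N - 1, by omega⟩ ^ 2)) := by
  have hH : Differentiable ℝ ((pinnedChain ω₂ lam β γ).hamiltonian N) :=
    (pinnedChain_contDiff_hamiltonian ω₂ lam β γ N (n := 1)).differentiable one_ne_zero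
  have hχ : Differentiable ℝ fun y : PhaseSpace N => smoothCutoff ((pinnedChain ω₂ lam β γ).hamiltonian N y / R) :=
    (pinnedChain_contDiff_cutoff N γ R (ω₂ := ω₂) (lam := lam) (β := β)).differentiable (by simp)
  rw [carreDuChamp_comp_left _ _ (hasDerivAt_cutoffProfile R) hH, carreDuChamp_comm,
    carreDuChamp_comp_left _ _ (hasDerivAt_cutoffProfile R) hH,
    pinnedChain_carreDuChamp_hamiltonian N hN hγT x]
  ring

/-- **`Γ(χ_R, χ_R) ≤ (S₁²/R²) 2γT (p_0² + p_{N-1}²)`** for `|χ'| ≤ S₁`. -/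
theorem pinnedChain_carreDuChamp_cutoff_le (hN : 0 < N) {T : ℝ} (hγT : 0 ≤ 2 * γ * T) {S₁ : ℝ}
    (hS₁ : ∀ v, |deriv smoothCutoff v| ≤ S₁) {R : ℝ} (hR : 0 < R) (x : PhaseSpace N) :
    carreDuChamp ((pinnedChain ω₂ lam β γ).bathVecL N T) ((pinnedChain ω₂ lam β γ).bathVecR N T)
        (fun y => smoothCutoff ((pinnedChain ω₂ lam β γ).hamiltonian N y / R))
        (fun y => smoothCutoff ((pinnedChain ω₂ lam β γ).hamiltonian N y / R)) x ≤
      S₁ ^ 2 / R ^ 2 * (2 * γ * T * (x.2 ⟨0, hN⟩ ^ 2 + x.2 ⟨N - 1, by omega⟩ ^ 2)) := by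
  rw [pinnedChain_carreDuChamp_cutoff N hN hγT R x, div_pow]
  refine mul_le_mul_of_nonneg_right (div_le_div_of_nonneg_right ?_ (by positivity)) (by positivity)
  have h := hS₁ ((pinnedChain ω₂ lam β γ).hamiltonian N x / R)
  have hS0 : 0 ≤ S₁ := (abs_nonneg _).trans h
  nlinarith [abs_nonneg (deriv smoothCutoff ((pinnedChain ω₂ lam β γ).hamiltonian N x / R)),
    sq_abs (deriv smoothCutoff ((pinnedChain ω₂ lam β γ).hamiltonian N x / R))]

/-- A sum over sites weighted by a bath indicator picks the bath site. -/
theorem sum_ite_val_eq {k : ℕ} (hk : k < N) (g : Fin N → ℝ) :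
    ∑ i : Fin N, (if i.val = k then g i else 0) = g ⟨k, hk⟩ := by
  rw [Finset.sum_eq_single_of_mem (⟨k, hk⟩ : Fin N) (Finset.mem_univ _)]
  · simp
  · intro b _ hb
    rw [if_neg]
    exact fun h => hb (Fin.ext h)

/-- **The generator of the squared cutoff in closed form**: with `q(h) = χ(h/R)²`,
`L(q∘H) = γ ∑_b (T (q''(H) p_b² + q'(H)) - q'(H) p_b²)` over the two bath sites. -/
theorem pinnedChain_generator_sqCutoff (hN : 0 < N) (T R : ℝ) (x : PhaseSpace N) :
    (pinnedChain ω₂ lam β γ).generator N T T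
        (fun y => smoothCutoff ((pinnedChain ω₂ lam β γ).hamiltonian N y / R) ^ 2) x =
      γ * ((T * ((2 * (deriv smoothCutoff ((pinnedChain ω₂ lam β γ).hamiltonian N x / R) ^ 2 +
              smoothCutoff ((pinnedChain ω₂ lam β γ).hamiltonian N x / R) *
                deriv (deriv smoothCutoff) ((pinnedChain ω₂ lam β γ).hamiltonian N x / R)) / R ^ 2) *
              x.2 ⟨0, hN⟩ ^ 2 +
            2 * smoothCutoff ((pinnedChain ω₂ lam β γ).hamiltonian N x / R) *
              deriv smoothCutoff ((pinnedChain ω₂ lam β γ).hamiltonian N x / R) / R) -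
          2 * smoothCutoff ((pinnedChain ω₂ lam β γ).hamiltonian N x / R) *
            deriv smoothCutoff ((pinnedChain ω₂ lam β γ).hamiltonian N x / R) / R * x.2 ⟨0, hN⟩ ^ 2) +
        (T * ((2 * (deriv smoothCutoff ((pinnedChain ω₂ lam β γ).hamiltonian N x / R) ^ 2 +
              smoothCutoff ((pinnedChain ω₂ lam β γ).hamiltonian N x / R) *
                deriv (deriv smoothCutoff) ((pinnedChain ω₂ lam β γ).hamiltonian N x / R)) / R ^ 2) *
              x.2 ⟨N - 1, by omega⟩ ^ 2 +
            2 * smoothCutoff ((pinnedChain ω₂ lam β γ).hamiltonian N x / R) *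
              deriv smoothCutoff ((pinnedChain ω₂ lam β γ).hamiltonian N x / R) / R) -
          2 * smoothCutoff ((pinnedChain ω₂ lam β γ).hamiltonian N x / R) *
            deriv smoothCutoff ((pinnedChain ω₂ lam β γ).hamiltonian N x / R) / R *
            x.2 ⟨N - 1, by omega⟩ ^ 2)) := by
  have hH : Differentiable ℝ ((pinnedChain ω₂ lam β γ).hamiltonian N) :=
    (pinnedChain_contDiff_hamiltonian ω₂ lam β γ N (n := 1)).differentiable one_ne_zero
  rw [(pinnedChain ω₂ lam β γ).generator_comp_hamiltonian hH (hasDerivAt_sqCutoffProfile R)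
    (hasDerivAt_deriv_sqCutoffProfile R) T T x, Finset.sum_add_distrib,
    sum_ite_val_eq N hN, sum_ite_val_eq N (by omega : N - 1 < N)]
  rfl

/-- **`|L(χ_R²)| ≤ γ (T A + B)(p_0² + p_{N-1}²) + 2γT B`** with `A = 2(S₁² + S₂)`, `B = 2S₁`, for
`R ≥ 1`, `γ, T ≥ 0`, `|χ'| ≤ S₁`, `|χ''| ≤ S₂`. -/
theorem pinnedChain_abs_generator_sqCutoff_le (hN : 0 < N) (hγ : 0 ≤ γ) {T : ℝ} (hT : 0 ≤ T) {S₁ S₂ : ℝ}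
    (hS₁ : ∀ v, |deriv smoothCutoff v| ≤ S₁) (hS₂ : ∀ v, |deriv (deriv smoothCutoff) v| ≤ S₂)
    {R : ℝ} (hR : 1 ≤ R) (x : PhaseSpace N) :
    |(pinnedChain ω₂ lam β γ).generator N T T
        (fun y => smoothCutoff ((pinnedChain ω₂ lam β γ).hamiltonian N y / R) ^ 2) x| ≤
      γ * (T * (2 * (S₁ ^ 2 + S₂)) + 2 * S₁) * (x.2 ⟨0, hN⟩ ^ 2 + x.2 ⟨N - 1, by omega⟩ ^ 2) +
        2 * γ * T * (2 * S₁) := by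
  rw [pinnedChain_generator_sqCutoff N hN T R x]
  set h := (pinnedChain ω₂ lam β γ).hamiltonian N x / R
  set c := smoothCutoff h
  set c' := deriv smoothCutoff h
  set c'' := deriv (deriv smoothCutoff) h
  set a := x.2 ⟨0, hN⟩ ^ 2 with ha
  set b := x.2 ⟨N - 1, by omega⟩ ^ 2 with hb
  have ha0 : 0 ≤ a := sq_nonneg _
  have hb0 : 0 ≤ b := sq_nonneg _
  have hc0 : 0 ≤ c := smoothCutoff_nonneg _
  have hc1 : c ≤ 1 := smoothCutoff_le_one _
  have h1 : |c'| ≤ S₁ := hS₁ h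
  have h2 : |c''| ≤ S₂ := hS₂ h
  have hS10 : 0 ≤ S₁ := (abs_nonneg _).trans h1
  have hS20 : 0 ≤ S₂ := (abs_nonneg _).trans h2
  have hR0 : 0 < R := by linarith
  -- bounds on `q'` and `q''`
  have hq' : |2 * c * c' / R| ≤ 2 * S₁ := by
    rw [abs_div, abs_of_pos hR0, div_le_iff₀ hR0, abs_mul, abs_mul, abs_two, abs_of_nonneg hc0]
    nlinarith [abs_nonneg c']
  have hq'' : |2 * (c' ^ 2 + c * c'') / R ^ 2| ≤ 2 * (S₁ ^ 2 + S₂) := by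
    rw [abs_div, abs_of_pos (by positivity : (0:ℝ) < R ^ 2), div_le_iff₀ (by positivity), abs_mul, abs_two]
    have h3 : |c' ^ 2 + c * c''| ≤ S₁ ^ 2 + S₂ := by
      calc _ ≤ |c' ^ 2| + |c * c''| := abs_add_le _ _
        _ ≤ S₁ ^ 2 + S₂ := by
          rw [abs_pow, abs_mul, abs_of_nonneg hc0]
          exact add_le_add (pow_le_pow_left₀ (abs_nonneg _) h1 2) (by nlinarith [abs_nonneg c''])
    have hR2 : 1 ≤ R ^ 2 := by nlinarith
    nlinarith [abs_nonneg (c' ^ 2 + c * c'')]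
  -- assemble
  set q' := 2 * c * c' / R with hq'_def
  set q'' := 2 * (c' ^ 2 + c * c'') / R ^ 2 with hq''_def
  have e : γ * ((T * (q'' * a + q') - q' * a) + (T * (q'' * b + q') - q' * b)) =
      γ * ((T * q'' - q') * (a + b)) + 2 * γ * T * q' := by ring
  rw [e]
  have hγT : 0 ≤ γ * T := mul_nonneg hγ hT
  calc _ ≤ |γ * ((T * q'' - q') * (a + b))| + |2 * γ * T * q'| := abs_add_le _ _
    _ = γ * (|T * q'' - q'| * (a + b)) + 2 * γ * T * |q'| := by
        rw [abs_mul, abs_of_nonneg hγ, abs_mul, abs_of_nonneg (by positivity : 0 ≤ a + b), abs_mul,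
          abs_of_nonneg (by positivity : 0 ≤ 2 * γ * T)]
    _ ≤ γ * ((T * (2 * (S₁ ^ 2 + S₂)) + 2 * S₁) * (a + b)) + 2 * γ * T * (2 * S₁) := by
        refine add_le_add (mul_le_mul_of_nonneg_left (mul_le_mul_of_nonneg_right ?_ (by positivity)) hγ)
          (mul_le_mul_of_nonneg_left hq' (by positivity))
        calc |T * q'' - q'| ≤ |T * q''| + |q'| := abs_sub _ _
          _ ≤ T * (2 * (S₁ ^ 2 + S₂)) + 2 * S₁ := by
              rw [abs_mul, abs_of_nonneg hT]
              exact add_le_add (mul_le_mul_of_nonneg_left hq'' hT) hq'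
    _ = _ := by ring


/-- **The generator of the cutoff in closed form**: with `q(h) = χ(h/R)`,
`L(q∘H) = γ ∑_b (T (q''(H) p_b² + q'(H)) - q'(H) p_b²)` over the two bath sites. -/
theorem pinnedChain_generator_cutoff (hN : 0 < N) (T R : ℝ) (x : PhaseSpace N) :
    (pinnedChain ω₂ lam β γ).generator N T T
        (fun y => smoothCutoff ((pinnedChain ω₂ lam β γ).hamiltonian N y / R)) x =
      γ * ((T * (deriv (deriv smoothCutoff) ((pinnedChain ω₂ lam β γ).hamiltonian N x / R) / R ^ 2 *
              x.2 ⟨0, hN⟩ ^ 2 + deriv smoothCutoff ((pinnedChain ω₂ lam β γ).hamiltonian N x / R) / R) -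
          deriv smoothCutoff ((pinnedChain ω₂ lam β γ).hamiltonian N x / R) / R * x.2 ⟨0, hN⟩ ^ 2) +
        (T * (deriv (deriv smoothCutoff) ((pinnedChain ω₂ lam β γ).hamiltonian N x / R) / R ^ 2 *
              x.2 ⟨N - 1, by omega⟩ ^ 2 + deriv smoothCutoff ((pinnedChain ω₂ lam β γ).hamiltonian N x / R) / R) -
          deriv smoothCutoff ((pinnedChain ω₂ lam β γ).hamiltonian N x / R) / R * x.2 ⟨N - 1, by omega⟩ ^ 2)) := by
  have hH : Differentiable ℝ ((pinnedChain ω₂ lam β γ).hamiltonian N) :=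
    (pinnedChain_contDiff_hamiltonian ω₂ lam β γ N (n := 1)).differentiable one_ne_zero
  rw [(pinnedChain ω₂ lam β γ).generator_comp_hamiltonian hH (hasDerivAt_cutoffProfile R)
    (hasDerivAt_deriv_cutoffProfile R) T T x, Finset.sum_add_distrib,
    sum_ite_val_eq N hN, sum_ite_val_eq N (by omega : N - 1 < N)]
  rfl

/-- **`|L(χ_R)| ≤ (γ (T S₂ + S₁)(p_0² + p_{N-1}²) + 2γT S₁) / R`** for `R ≥ 1`, `γ, T ≥ 0`,
`|χ'| ≤ S₁`, `|χ''| ≤ S₂`. -/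
theorem pinnedChain_abs_generator_cutoff_le (hN : 0 < N) (hγ : 0 ≤ γ) {T : ℝ} (hT : 0 ≤ T) {S₁ S₂ : ℝ}
    (hS₁ : ∀ v, |deriv smoothCutoff v| ≤ S₁) (hS₂ : ∀ v, |deriv (deriv smoothCutoff) v| ≤ S₂)
    {R : ℝ} (hR : 1 ≤ R) (x : PhaseSpace N) :
    |(pinnedChain ω₂ lam β γ).generator N T T
        (fun y => smoothCutoff ((pinnedChain ω₂ lam β γ).hamiltonian N y / R)) x| ≤
      (γ * (T * S₂ + S₁) * (x.2 ⟨0, hN⟩ ^ 2 + x.2 ⟨N - 1, by omega⟩ ^ 2) + 2 * γ * T * S₁) / R := by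
  rw [pinnedChain_generator_cutoff N hN T R x]
  set h := (pinnedChain ω₂ lam β γ).hamiltonian N x / R
  set c' := deriv smoothCutoff h
  set c'' := deriv (deriv smoothCutoff) h
  set a := x.2 ⟨0, hN⟩ ^ 2 with ha
  set b := x.2 ⟨N - 1, by omega⟩ ^ 2 with hb
  have ha0 : 0 ≤ a := sq_nonneg _
  have hb0 : 0 ≤ b := sq_nonneg _
  have h1 : |c'| ≤ S₁ := hS₁ h
  have h2 : |c''| ≤ S₂ := hS₂ h
  have hS10 : 0 ≤ S₁ := (abs_nonneg _).trans h1
  have hS20 : 0 ≤ S₂ := (abs_nonneg _).trans h2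
  have hR0 : 0 < R := by linarith
  have hR1 : 1 / R ^ 2 ≤ 1 / R := by
    rw [div_le_div_iff₀ (by positivity) hR0]; nlinarith
  -- bounds on `q' = c'/R` and `q'' = c''/R²`
  have hq' : |c' / R| ≤ S₁ / R := by
    rw [abs_div, abs_of_pos hR0]; exact div_le_div_of_nonneg_right h1 hR0.le
  have hq'' : |c'' / R ^ 2| ≤ S₂ / R := by
    rw [abs_div, abs_of_pos (by positivity : (0:ℝ) < R ^ 2)]
    calc |c''| / R ^ 2 ≤ S₂ / R ^ 2 := div_le_div_of_nonneg_right h2 (by positivity)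
      _ = S₂ * (1 / R ^ 2) := by ring
      _ ≤ S₂ * (1 / R) := mul_le_mul_of_nonneg_left hR1 hS20
      _ = S₂ / R := by ring
  set q' := c' / R with hq'_def
  set q'' := c'' / R ^ 2 with hq''_def
  have e : γ * ((T * (q'' * a + q') - q' * a) + (T * (q'' * b + q') - q' * b)) =
      γ * ((T * q'' - q') * (a + b)) + 2 * γ * T * q' := by ring
  rw [e]
  have hγT : 0 ≤ γ * T := mul_nonneg hγ hT
  calc _ ≤ |γ * ((T * q'' - q') * (a + b))| + |2 * γ * T * q'| := abs_add_le _ _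
    _ = γ * (|T * q'' - q'| * (a + b)) + 2 * γ * T * |q'| := by
        rw [abs_mul, abs_of_nonneg hγ, abs_mul, abs_of_nonneg (by positivity : 0 ≤ a + b), abs_mul,
          abs_of_nonneg (by positivity : 0 ≤ 2 * γ * T)]
    _ ≤ γ * ((T * (S₂ / R) + S₁ / R) * (a + b)) + 2 * γ * T * (S₁ / R) := by
        refine add_le_add (mul_le_mul_of_nonneg_left (mul_le_mul_of_nonneg_right ?_ (by positivity)) hγ)
          (mul_le_mul_of_nonneg_left hq' (by positivity))
        calc |T * q'' - q'| ≤ |T * q''| + |q'| := abs_sub _ _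
          _ ≤ T * (S₂ / R) + S₁ / R := by
              rw [abs_mul, abs_of_nonneg hT]
              exact add_le_add (mul_le_mul_of_nonneg_left hq'' hT) hq'
    _ = _ := by
        field_simp

end Cutoff

end Summit.AtomisticToContinuum.FouriersLaw.Theorems

end
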